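import Literature.IUT.HodgeTheaters.InitialThetaDataTorsionCuspModelPointNormaliser
import Literature.IUT.HodgeTheaters.InitialThetaDataTorsionCuspModelModLCuspLaws
import HarnessLib

/-!
# [IUTchI] §1 pp.37–38 / Def 6.1: abc-iut-L5-t1's `ModLCuspLaws` at the SINGLE-POINT cusp model `pedOf₄` / `regeom₄`, the
# printed claims, and the FULL JOINT binder set `{CG, M′, hL, hA, hS}` at ONE datum (NV-L5 row «JOINT-NV-CG (l cusps)»,
# stage C part C3)

S. Mochizuki, *Inter-universal Teichmüller theory I*, kurims manuscript (May 2020), §1 p. 37 l. 30 – p. 38 l. 24 (the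
`Δ_ε`-sentences quoted by the six laws (L0)–(L4) of `PuncturedEllipticData.ModLCuspLaws`, abc-iut-L5-t1 p446054), Def 6.1
(ii)(iii)(v) p. 157–158.  [claim: Mochizuki2012, status: disputed] (D-0012 claim key; series status DISPUTED — a MODEL of the
cell's `π₁`-interface structures; nothing of the series is asserted; no side taken on [IUTchIII] Cor. 3.12).

## WHAT (re-run of parts B5a–B5c at the single-point datum of parts C1–C2, C4; `U = 𝔽_l[E_F[l]]`, line `ℤ·g`)

* `Δ`-side of `pedOf₄` = `Δ`-side of `pedOf₃` (same `Π_X`, `Π_C̲`): the bounds `map_embU_cob_le_modLKer₃`, `modLKer_le_lamKer₃`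
  are re-used BY NAME; new: `mem_inertia₄`, `eq_embU_of_mem_inertia₄` (`I_q = ⟨embU(e_{s q})⟩`), (L4) `inertia_central₄`, the
  detector `Λ_{s(ε′)}` (`lam_e_s`: `Λ_{s ε′}(e_{s x}) = [x = ε′]`), `deltaEpsKer_le_lamKer₄`;
* the point span `pointSpan g s := cob g ⊔ ⨆_{x ≠ ε⁰} ⟨e_{s x}⟩ = Ker Λ_1` (`mem_pointSpan_of_lam_one_eq_one`; NO relation among
  the `l` cusp classes is needed) and the `ℤ·g`-twisted additivity of `Λ_1` on `(U ⋊ ℤ·g) ⋊ {±1}` (`augL_mul`), whence (L3)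
  `iota_neg₄`; (L0)(L1)(L2a)(L2c) as in part B5c;
* **`modLCuspLaws₄`**, **`InitialThetaData.modLCuspLawsRegeom₄`**, **`arrowCoveringClaimsRegeom₄`** (t1's
  `arrowCoveringClaims_pe_of_modLCuspLaws` BY NAME), the FULL JOINT statement
  **`exists_joint_cuspGalois_unramified_laws_claims_normaliserStable`** = `{CG, M′ ⊇ (M, hI), hL, hA, hS}` at ONE datum over the
  same `(V^bad_mod, V̲)`, and **`nonempty_localArrowLaw_regeom₄`**: abc-iut-L5-d5's `Λ`-assembly (p446888) / abc-iut-L5-t4's binder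
  type `LocalArrowLaw` FIRE non-vacuously at `regeom₄` for every `G_v̲ ≤ G_F`.

HONEST LABEL «[model; single-point inertia; ALL typed §1/§6.1(v) binders INHABITED jointly]».  Model ≠ genuine datum; a model
witnesses consistency of OUR typed binders only; typed ≠ proved; no side taken on [IUTchIII] Cor. 3.12.
-/

noncomputable section

namespace Literature.IUT.HodgeTheaters

universe u

namespace TorsionCuspModel
open Literature.AnabelianGeometry.AbsoluteAnabelian Topology TorsionMonodromyModel
open Literature.AnabelianGeometry.EtaleTheta.SettingModel
open scoped WeierstrassCurve.Affine Classical Pointwise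

variable {F : Type u} [Field F] {E : WeierstrassCurve F} {Fbar : Type u} [Field Fbar] [Algebra F Fbar] {l : ℕ}

/-! ## `U`-level: the point span and the detector values -/

section PointSpan

variable {g : Tors E Fbar l} (s : Tors E Fbar l ⧸ Subgroup.zpowers g → Tors E Fbar l)

/-- The POINT SPAN `cob g ⊔ ⨆_{x ≠ ε⁰} ⟨e_{s x}⟩ ⊆ U`: the `U`-part of `I_{ε′}·I_{ε″}·Ker(Δ_X̲ ↠ Δ_ε)` at `pedOf₄`.
[cite: Mochizuki2012, IUTchI §1 p.37] -/
def pointSpan : Subgroup (U E Fbar l) :=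
  cob g ⊔ ⨆ x : {x : Tors E Fbar l ⧸ Subgroup.zpowers g // x ≠ 1}, Subgroup.zpowers (U.e (s x.1))

/-- [cite: Mochizuki2012, IUTchI §1 p.37] -/
theorem e_s_mem_pointSpan_of_ne {x : Tors E Fbar l ⧸ Subgroup.zpowers g} (hx : x ≠ 1) : U.e (s x) ∈ pointSpan s :=
  Subgroup.mem_sup_right (le_iSup (fun x : {x : Tors E Fbar l ⧸ Subgroup.zpowers g // x ≠ 1} =>
    Subgroup.zpowers (U.e (s x.1))) ⟨x, hx⟩ (Subgroup.mem_zpowers _))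

variable [E.IsElliptic] [NeZero l]
  (hs : ∀ q : Tors E Fbar l ⧸ Subgroup.zpowers g, (QuotientGroup.mk (s q) : _ ⧸ Subgroup.zpowers g) = q)
include hs

/-- **Detector values**: `Λ_{s b}(e_{s x}) = [x = b]`. [cite: Mochizuki2012, IUTchI §1 p.37] -/
theorem lam_e_s (b x : Tors E Fbar l ⧸ Subgroup.zpowers g) :
    lam g (s b) (U.e (s x)) = Multiplicative.ofAdd (if x = b then (1 : ZMod l) else 0) := by
  rw [lam_apply, cosetSum_e]
  have : ((s b)⁻¹ * s x ∈ Subgroup.zpowers g ↔ x = b) := by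
    rw [← QuotientGroup.eq_one_iff, QuotientGroup.mk_mul, QuotientGroup.mk_inv, hs, hs, inv_mul_eq_one, eq_comm]
  simp only [this]

omit [E.IsElliptic] [NeZero l] in
/-- `e_P ≡ e_{s[P]}` modulo `I_{ℤ·g}·U`. [cite: Mochizuki2012, IUTchI §1 p.37] -/
theorem e_mul_inv_e_s_mem_cob (P : Tors E Fbar l) :
    U.e P * (U.e (s (QuotientGroup.mk P)))⁻¹ ∈ cob (E := E) (Fbar := Fbar) g := by
  have hk : (s (QuotientGroup.mk P))⁻¹ * P ∈ Subgroup.zpowers g := by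
    rw [← QuotientGroup.eq_one_iff, QuotientGroup.mk_mul, QuotientGroup.mk_inv, hs, inv_mul_cancel]
  have := e_mul_inv_e_mem_cob (E := E) (Fbar := Fbar) hk (s (QuotientGroup.mk P))
  rwa [mul_inv_cancel_left] at this

/-- `Λ_1(e_{s x}) = [x = ε⁰]`. [cite: Mochizuki2012, IUTchI §1 p.37] -/
theorem lam_one_e_s (x : Tors E Fbar l ⧸ Subgroup.zpowers g) :
    lam g 1 (U.e (s x)) = Multiplicative.ofAdd (if x = 1 then (1 : ZMod l) else 0) := by
  rw [lam_apply, cosetSum_e, inv_one, one_mul]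
  have : (s x ∈ Subgroup.zpowers g ↔ x = 1) := by rw [← QuotientGroup.eq_one_iff, hs]
  simp only [this]

omit hs in
/-- `I_{ℤ·g}·U ⊆ Ker Λ_b`. [cite: Mochizuki2012, IUTchI §1 p.37] -/
theorem cob_le_ker_lam (b : Tors E Fbar l) : cob g ≤ (lam (E := E) (Fbar := Fbar) g b).ker := by
  rw [cob, Subgroup.closure_le]
  rintro _ ⟨t, ht, f, rfl⟩
  rw [SetLike.mem_coe, MonoidHom.mem_ker, map_mul, map_inv, lam_transl ht, mul_inv_cancel]

/-- `pointSpan ⊆ Ker Λ_1`. [cite: Mochizuki2012, IUTchI §1 p.37] -/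
theorem pointSpan_le_ker_lam_one : pointSpan s ≤ (lam (E := E) (Fbar := Fbar) g 1).ker :=
  sup_le (cob_le_ker_lam 1) (iSup_le fun x => Subgroup.zpowers_le.mpr (by
    rw [MonoidHom.mem_ker, lam_one_e_s s hs, if_neg x.2, ofAdd_zero]))

/-- **`Ker Λ_1 ⊆ pointSpan`**: basis induction (`e_P ≡ e_{s[P]}` modulo `I_{ℤ·g}·U`; `Λ_1(e_{s ε⁰}^k) = k`); NO relation among the
cusp classes is needed in the single-point model. [cite: Mochizuki2012, IUTchI §1 p.37] -/
theorem mem_pointSpan_of_lam_one_eq_one {w : U E Fbar l} (hw : lam g 1 w = 1) : w ∈ pointSpan s := by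
  have hall : ∀ w : U E Fbar l, w ∈ pointSpan s ⊔ Subgroup.zpowers (U.e (s 1)) := fun w => by
    refine Pi.single_induction (M := fun _ : Tors E Fbar l => ZMod l)
      (fun f => (Multiplicative.ofAdd f : U E Fbar l) ∈ pointSpan s ⊔ Subgroup.zpowers (U.e (s 1)))
      (Multiplicative.toAdd w) (by rw [ofAdd_zero]; exact one_mem _)
      (fun f f' hf hf' => by rw [ofAdd_add]; exact mul_mem hf hf') (fun P m => ?_)
    have e1 : (Multiplicative.ofAdd (Pi.single P m) : U E Fbar l) = U.e P ^ (m.val : ℤ) := by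
      refine U.ext fun Q => ?_
      rw [toAdd_ofAdd, toAdd_zpow, Pi.smul_apply, U.toAdd_e_apply, Pi.single_apply, smul_ite, smul_zero,
        zsmul_eq_mul, mul_one, Int.cast_natCast, ZMod.natCast_zmod_val]
    rw [e1, show U.e P ^ (m.val : ℤ) = (U.e P * (U.e (s (QuotientGroup.mk P)))⁻¹) ^ (m.val : ℤ) *
      U.e (s (QuotientGroup.mk P)) ^ (m.val : ℤ) by rw [← mul_zpow, inv_mul_cancel_right]]
    refine mul_mem (Subgroup.mem_sup_left (Subgroup.mem_sup_left (Subgroup.zpow_mem _ (e_mul_inv_e_s_mem_cob s hs P) _))) ?_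
    by_cases h1 : (QuotientGroup.mk P : _ ⧸ Subgroup.zpowers g) = 1
    · rw [h1]; exact Subgroup.mem_sup_right (Subgroup.zpow_mem _ (Subgroup.mem_zpowers _) _)
    · exact Subgroup.mem_sup_left (Subgroup.zpow_mem _ (e_s_mem_pointSpan_of_ne s h1) _)
  obtain ⟨y, hy, z, hz, rfl⟩ := Subgroup.mem_sup.mp (hall w)
  obtain ⟨k, rfl⟩ := Subgroup.mem_zpowers_iff.mp hz
  rw [map_mul, MonoidHom.mem_ker.mp (pointSpan_le_ker_lam_one s hs hy), one_mul, map_zpow, lam_one_e_s s hs,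
    if_pos rfl, ← ofAdd_zsmul, zsmul_eq_mul, mul_one, ofAdd_eq_one] at hw
  rw [U.zpow_eq_one_of_cast_eq_zero _ hw, mul_one]
  exact hy

omit hs in
/-- Additive `ℤ·g`-invariance of `Λ_b`. [cite: Mochizuki2012, IUTchI §1 p.37] -/
theorem cosetSum_transl {b t : Tors E Fbar l} (ht : t ∈ Subgroup.zpowers g) (w : U E Fbar l) :
    cosetSum g b (Multiplicative.toAdd (transl E Fbar l t w)) = cosetSum g b (Multiplicative.toAdd w) :=
  Multiplicative.ofAdd.injective (lam_transl ht w)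

omit hs in
/-- `Λ_1((1,u)·w) = ε(u)·Λ_1(w)` (the line is stable under inversion). [cite: Mochizuki2012, IUTchI §1 p.38] -/
theorem cosetSum_one_outU_inr (u : ℤˣ) (w : U E Fbar l) :
    cosetSum g 1 (Multiplicative.toAdd (outU E l (1, u) w)) = ((u : ℤ) : ZMod l) * cosetSum g 1 (Multiplicative.toAdd w) := by
  rw [cosetSum_apply, cosetSum_apply, Finset.mul_sum]
  refine Finset.sum_nbij' (· ^ (u : ℤ)) (· ^ (u : ℤ)) (fun k hk => ?_) (fun k hk => ?_) (fun k _ => ?_) (fun k _ => ?_)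
    (fun k _ => by rw [one_mul, one_mul, toAdd_outU_apply, act_inr_symm_apply]; rfl)
  · exact mem_lineFinset.mpr (Subgroup.zpow_mem _ (mem_lineFinset.mp hk) _)
  · exact mem_lineFinset.mpr (Subgroup.zpow_mem _ (mem_lineFinset.mp hk) _)
  all_goals rw [← zpow_mul, ← Units.val_mul, Int.units_mul_self, Units.val_one, zpow_one]

omit hs in
/-- `Λ_1(d_U)` on `DihU`. [cite: Mochizuki2012, IUTchI §1 p.38] -/
def augL (g : Tors E Fbar l) (d : DihU F E Fbar l) : ZMod l := cosetSum g 1 (Multiplicative.toAdd d.left.left)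

omit hs in
/-- Twisted additivity `Λ_1((d₁d₂)_U) = Λ_1(d₁,U) + ε(u₁)Λ_1(d₂,U)` when `t_{d₁} ∈ ℤ·g`. [cite: Mochizuki2012, IUTchI §1 p.38] -/
theorem augL_mul {d₁ : DihU F E Fbar l} (h1 : d₁.left.right ∈ Subgroup.zpowers g) (d₂ : DihU F E Fbar l) :
    augL g (d₁ * d₂) = augL g d₁ + ((d₁.right : ℤ) : ZMod l) * augL g d₂ := by
  rw [augL, augL, augL, SemidirectProduct.mul_left, SemidirectProduct.mul_left, toAdd_mul, map_add, cosetSum_transl h1,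
    outerK_apply, outer_apply_left, cosetSum_one_outU_inr]

omit hs in
/-- [cite: Mochizuki2012, IUTchI §1 p.38] -/
theorem augL_one : augL (F := F) (E := E) (Fbar := Fbar) g 1 = 0 := by
  rw [augL, SemidirectProduct.one_left, SemidirectProduct.one_left, toAdd_one, map_zero]

omit hs in
/-- [cite: Mochizuki2012, IUTchI §1 p.38] -/
theorem augL_inv {d : DihU F E Fbar l} (h1 : d.left.right ∈ Subgroup.zpowers g) :
    augL g d⁻¹ = -(((d.right : ℤ) : ZMod l) * augL g d) := by
  have h0 := augL_mul h1 d⁻¹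
  rw [mul_inv_cancel, augL_one] at h0
  have hsq : ((d.right : ℤ) : ZMod l) * ((d.right : ℤ) : ZMod l) = 1 := by
    rw [← Int.cast_mul, ← Units.val_mul, Int.units_mul_self, Units.val_one, Int.cast_one]
  calc augL g d⁻¹ = ((d.right : ℤ) : ZMod l) * (((d.right : ℤ) : ZMod l) * augL g d⁻¹) := by rw [← mul_assoc, hsq, one_mul]
    _ = ((d.right : ℤ) : ZMod l) * (-augL g d) := by rw [eq_neg_of_add_eq_zero_right h0.symm]
    _ = -(((d.right : ℤ) : ZMod l) * augL g d) := mul_neg _ _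

omit hs in
/-- **`Λ_1((c v c⁻¹ v)_U) = 0`** for `c, v` over the line with `u_c = −1`, `u_v = 1`. [cite: Mochizuki2012, IUTchI §1 p.38] -/
theorem augL_conj_mul_self {c v : DihU F E Fbar l} (hcC : c ∈ dC F E g) (hvC : v ∈ dC F E g) (hc : c.right = -1)
    (hv : v.right = 1) : augL g (c * v * c⁻¹ * v) = 0 := by
  have h1 : c.left.right ∈ Subgroup.zpowers g := (mem_dC_iff _ _).mp hcC
  have h2 : (c * v).left.right ∈ Subgroup.zpowers g := (mem_dC_iff _ _).mp (mul_mem hcC hvC)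
  have h3 : (c * v * c⁻¹).left.right ∈ Subgroup.zpowers g :=
    (mem_dC_iff _ _).mp (mul_mem (mul_mem hcC hvC) (inv_mem hcC))
  rw [augL_mul h3, augL_mul h2, augL_mul h1, augL_inv h1]
  simp only [SemidirectProduct.mul_right, SemidirectProduct.inv_right, Int.units_inv_eq_self, hc, hv, mul_one,
    Int.units_mul_self, Units.val_neg, Units.val_one, Int.cast_neg, Int.cast_one]
  ring

end PointSpan

/-! ## The laws at `pedOf₄` -/

section Laws

variable (G : Type u) [Group G] [TopologicalSpace G] [IsTopologicalGroup G] [CompactSpace G]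
  [TotallyDisconnectedSpace G] [E.IsElliptic] [NeZero l]
  {g : Tors E Fbar l} (s : Tors E Fbar l ⧸ Subgroup.zpowers g → Tors E Fbar l) (a : Tors E Fbar l)
  (hl : l.Prime) (ha : a ∉ Subgroup.zpowers g) (h5 : 5 ≤ l) (h6 : l.Coprime 6) (hg : g ≠ 1)
  (hcard : Nat.card (Tors E Fbar l) = l ^ 2)
  (hs : ∀ q : Tors E Fbar l ⧸ Subgroup.zpowers g, (QuotientGroup.mk (s q) : _ ⧸ Subgroup.zpowers g) = q)

/-- `Δ_X̲` of `pedOf₄` = `Δ_X̲` of `pedOf₃`. [cite: Mochizuki2012, IUTchI §1 p.37] -/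
theorem mem_deltaXbar₄ {x : (pedOf₄ F E Fbar l G g s a hl ha h5 h6).PiC} : x ∈ (pedOf₄ F E Fbar l G g s a hl ha h5 h6).DeltaXbar ↔ x.1 = 1 ∧ x.2.right = 1 ∧ x.2.left.right ∈ Subgroup.zpowers g :=
  mem_deltaXbar₃ G s 1 a hl ha h5 h6

/-- [cite: Mochizuki2012, IUTchI §1 p.37] -/
theorem mem_deltaCbar₄ {x : (pedOf₄ F E Fbar l G g s a hl ha h5 h6).PiC} : x ∈ (pedOf₄ F E Fbar l G g s a hl ha h5 h6).DeltaCbar ↔ x.1 = 1 ∧ x.2.left.right ∈ Subgroup.zpowers g :=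
  mem_deltaCbar₃ G s 1 a hl ha h5 h6

/-- `I_q = 1 × ⟨igenP_q⟩`. [cite: Mochizuki2012, IUTchI §1 p.37] -/
theorem mem_inertia₄ {x : (pedOf₄ F E Fbar l G g s a hl ha h5 h6).PiC} {q : Tors E Fbar l ⧸ Subgroup.zpowers g} :
    x ∈ (pedOf₄ F E Fbar l G g s a hl ha h5 h6).inertia q ↔ x.1 = 1 ∧ x.2 ∈ Subgroup.zpowers (igenP (F := F) s q) := by
  show x.2 ∈ Subgroup.zpowers (igenP (F := F) s q) ∧ x.1 = 1 ↔ _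
  tauto

/-- Elements of `I_q` are `embU (e_{s q}^n)`. [cite: Mochizuki2012, IUTchI §1 p.37] -/
theorem eq_embU_of_mem_inertia₄ {x : (pedOf₄ F E Fbar l G g s a hl ha h5 h6).PiC} {q : Tors E Fbar l ⧸ Subgroup.zpowers g} (hx : x ∈ (pedOf₄ F E Fbar l G g s a hl ha h5 h6).inertia q) :
    ∃ n : ℤ, x = embU G (U.e (s q) ^ n) := by
  obtain ⟨hx1, hx2⟩ := (mem_inertia₄ G s a hl ha h5 h6).mp hx
  obtain ⟨n, hn⟩ := Subgroup.mem_zpowers_iff.mp hx2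
  refine ⟨n, Prod.ext hx1 ?_⟩
  rw [embU_snd, map_zpow, map_zpow, ← hn, igenP]

/-- (L4) at `pedOf₄`. [cite: Mochizuki2012, IUTchI §1 p.38] -/
theorem inertia_central₄ (q : Tors E Fbar l ⧸ Subgroup.zpowers g) (x : (pedOf₄ F E Fbar l G g s a hl ha h5 h6).PiC) (hx : x ∈ (pedOf₄ F E Fbar l G g s a hl ha h5 h6).PiXbar) (z : (pedOf₄ F E Fbar l G g s a hl ha h5 h6).PiC)
    (hz : z ∈ (pedOf₄ F E Fbar l G g s a hl ha h5 h6).inertia q) : x * z * x⁻¹ * z⁻¹ ∈ (pedOf₄ F E Fbar l G g s a hl ha h5 h6).modLKer := by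
  obtain ⟨n, hn⟩ := eq_embU_of_mem_inertia₄ G s a hl ha h5 h6 hz
  obtain ⟨hxr, hxt⟩ := (mem_dXbar_iff g x.2).mp ⟨mem_liftU.mp (Subgroup.mem_inf.mp hx).1,
    mem_liftU.mp (Subgroup.mem_inf.mp hx).2⟩
  have key : x * z * x⁻¹ * z⁻¹ =
      embU G (transl E Fbar l x.2.left.right (U.e (s q) ^ n) * (U.e (s q) ^ n)⁻¹) := by
    refine Prod.ext ?_ ?_
    · change x.1 * z.1 * x.1⁻¹ * z.1⁻¹ = 1
      rw [hn, embU_fst, mul_one, inv_one, mul_one, mul_inv_cancel]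
    · change x.2 * z.2 * x.2⁻¹ * z.2⁻¹ = SemidirectProduct.inl (SemidirectProduct.inl _)
      rw [hn, embU_snd, conj_inl_inl, hxr, Prod.mk_one_one, outU_one, MulAut.one_apply, map_mul, map_mul, map_inv,
        map_inv]
  rw [key]
  exact embU_mem_modLKer₃_of_mem_cob G s 1 a hl ha h5 h6 (transl_mul_inv_mem_cob hxt _)

include hs in
/-- UPPER bound: the inertia of every cusp `q ≠ ε′` dies under the detector `Λ_{s ε′}`. [cite: Mochizuki2012, IUTchI §1 p.37] -/
theorem inertia_le_lamKer₄ {q : Tors E Fbar l ⧸ Subgroup.zpowers g} (hq1 : q ≠ QuotientGroup.mk a) :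
    (pedOf₄ F E Fbar l G g s a hl ha h5 h6).inertia q ≤ (pedOf₄ F E Fbar l G g s a hl ha h5 h6).DeltaC ⊓ liftU G (lamKer g (s (QuotientGroup.mk a))) := by
  intro x hx
  obtain ⟨n, rfl⟩ := eq_embU_of_mem_inertia₄ G s a hl ha h5 h6 hx
  refine Subgroup.mem_inf.mpr ⟨rfl, mem_liftU.mpr (mem_lamKer_iff.mpr ⟨(mem_dXbar_iff g _).mpr ⟨rfl, one_mem _⟩, ?_⟩)⟩
  show lam g (s (QuotientGroup.mk a)) (U.e (s q) ^ n) = 1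
  rw [map_zpow, lam_e_s s hs, if_neg hq1, ofAdd_zero, one_zpow]

include hs in
/-- [cite: Mochizuki2012, IUTchI §1 p.37] -/
theorem deltaEpsKer_le_lamKer₄ : (pedOf₄ F E Fbar l G g s a hl ha h5 h6).deltaEpsKer ≤ (pedOf₄ F E Fbar l G g s a hl ha h5 h6).DeltaC ⊓ liftU G (lamKer g (s (QuotientGroup.mk a))) :=
  sup_le (modLKer_le_lamKer₃ G s 1 a hl ha h5 h6 _) (iSup_le fun x => inertia_le_lamKer₄ G s a hl ha h5 h6 hs x.2.2.1)

include hs in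
/-- The detector sees `e_{s ε′}`: membership forces `l ∣ n`. [cite: Mochizuki2012, IUTchI §1 p.37] -/
theorem cast_eq_zero_of_embU_e_ε1_zpow_mem {n : ℤ}
    (hn : embU G (U.e (s (QuotientGroup.mk a)) ^ n) ∈ (pedOf₄ F E Fbar l G g s a hl ha h5 h6).DeltaC ⊓ liftU G (lamKer g (s (QuotientGroup.mk a)))) :
    (n : ZMod l) = 0 := by
  obtain ⟨-, hlam⟩ := mem_lamKer_iff.mp (mem_liftU.mp (Subgroup.mem_inf.mp hn).2)
  rw [embU_snd, SemidirectProduct.left_inl, SemidirectProduct.left_inl, map_zpow, lam_e_s s hs, if_pos rfl,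
    ← ofAdd_zsmul, ofAdd_eq_one, zsmul_eq_mul, mul_one] at hlam
  exact hlam

/-- LOWER bound for `I_{ε′}·I_{ε″}·Ker(Δ_X̲ ↠ Δ_ε)`: it contains `embU (pointSpan)`. [cite: Mochizuki2012, IUTchI §1 p.37] -/
theorem map_embU_pointSpan_le₄ : (pointSpan s).map (embU G) ≤ (pedOf₄ F E Fbar l G g s a hl ha h5 h6).inertia (pedOf₄ F E Fbar l G g s a hl ha h5 h6).ε1 ⊔ (pedOf₄ F E Fbar l G g s a hl ha h5 h6).inertia (pedOf₄ F E Fbar l G g s a hl ha h5 h6).ε2 ⊔ (pedOf₄ F E Fbar l G g s a hl ha h5 h6).deltaEpsKer := by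
  rw [Subgroup.map_le_iff_le_comap, pointSpan]
  refine sup_le (fun w hw => ?_) (iSup_le fun x => ?_)
  · exact ((pedOf₄ F E Fbar l G g s a hl ha h5 h6).modLKer_le_deltaEpsKer.trans le_sup_right) (embU_mem_modLKer₃_of_mem_cob G s 1 a hl ha h5 h6 hw)
  · rw [Subgroup.zpowers_le, Subgroup.mem_comap]
    obtain ⟨x, hx0⟩ := x
    have hI : embU G (U.e (s x)) ∈ (pedOf₄ F E Fbar l G g s a hl ha h5 h6).inertia x := (mem_inertia₄ G s a hl ha h5 h6).mpr ⟨rfl, Subgroup.mem_zpowers _⟩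
    rcases eq_or_ne x (QuotientGroup.mk a) with h1 | h1
    · subst h1
      exact Subgroup.mem_sup_left (Subgroup.mem_sup_left hI)
    rcases eq_or_ne x (QuotientGroup.mk a)⁻¹ with h2 | h2
    · subst h2
      exact Subgroup.mem_sup_left (Subgroup.mem_sup_right hI)
    · refine Subgroup.mem_sup_right (Subgroup.mem_sup_right ?_)
      exact le_iSup (fun y : {y : (pedOf₄ F E Fbar l G g s a hl ha h5 h6).Cusp // (pedOf₄ F E Fbar l G g s a hl ha h5 h6).IsNonzeroCusp y ∧ y ≠ (pedOf₄ F E Fbar l G g s a hl ha h5 h6).ε1 ∧ y ≠ (pedOf₄ F E Fbar l G g s a hl ha h5 h6).ε2} => (pedOf₄ F E Fbar l G g s a hl ha h5 h6).inertia y.1)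
        ⟨x, hx0, h1, h2⟩ hI

include hs in
/-- **(L3) at `pedOf₄`.** [cite: Mochizuki2012, IUTchI §1 p.38] -/
theorem iota_neg₄ (c : (pedOf₄ F E Fbar l G g s a hl ha h5 h6).PiC) (hc : c ∈ (pedOf₄ F E Fbar l G g s a hl ha h5 h6).DeltaCbar) (hcX : c ∉ (pedOf₄ F E Fbar l G g s a hl ha h5 h6).DeltaXbar) (v : (pedOf₄ F E Fbar l G g s a hl ha h5 h6).PiC) (hv : v ∈ (pedOf₄ F E Fbar l G g s a hl ha h5 h6).DeltaXbar) :
    c * v * c⁻¹ * v ∈ (pedOf₄ F E Fbar l G g s a hl ha h5 h6).inertia (pedOf₄ F E Fbar l G g s a hl ha h5 h6).ε1 ⊔ (pedOf₄ F E Fbar l G g s a hl ha h5 h6).inertia (pedOf₄ F E Fbar l G g s a hl ha h5 h6).ε2 ⊔ (pedOf₄ F E Fbar l G g s a hl ha h5 h6).deltaEpsKer := by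
  obtain ⟨hc1, hct⟩ := (mem_deltaCbar₄ G s a hl ha h5 h6).mp hc
  have hcu : c.2.right = -1 := (Int.units_eq_one_or c.2.right).resolve_left fun h1 =>
    hcX ((mem_deltaXbar₄ G s a hl ha h5 h6).mpr ⟨hc1, h1, hct⟩)
  obtain ⟨hv1, hvu, hvt⟩ := (mem_deltaXbar₄ G s a hl ha h5 h6).mp hv
  have e := conj_mul_self_eq_embU G hc1 hcu hv1 hvu
  have hA : augL g (c.2 * v.2 * c.2⁻¹ * v.2) = 0 :=
    augL_conj_mul_self ((mem_dC_iff _ _).mpr hct) ((mem_dC_iff _ _).mpr hvt) hcu hvu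
  have hw : lam g 1 (c.2 * v.2 * c.2⁻¹ * v.2).left.left = 1 := by
    rw [lam_apply]; exact congrArg Multiplicative.ofAdd hA
  exact e ▸ map_embU_pointSpan_le₄ G s a hl ha h5 h6 ⟨_, mem_pointSpan_of_lam_one_eq_one s hs hw, rfl⟩

/-- **(L0) at `pedOf₄`.** [cite: Mochizuki2012, IUTchI §1 p.37] -/
theorem modLKer_relIndex_ne_zero₄ : (pedOf₄ F E Fbar l G g s a hl ha h5 h6).modLKer.relIndex (pedOf₄ F E Fbar l G g s a hl ha h5 h6).DeltaXbar ≠ 0 :=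
  modLKer_relIndex_ne_zero₃ G s 1 a hl ha h5 h6

/-- **(L1) at `pedOf₄`.** [cite: Mochizuki2012, IUTchI §1 p.37] -/
theorem inertia_procyclic₄ (q : Tors E Fbar l ⧸ Subgroup.zpowers g) :
    ∃ z ∈ (pedOf₄ F E Fbar l G g s a hl ha h5 h6).inertia q, (pedOf₄ F E Fbar l G g s a hl ha h5 h6).inertia q ≤ (Subgroup.zpowers z).topologicalClosure := by
  refine ⟨embU G (U.e (s q)), (mem_inertia₄ G s a hl ha h5 h6).mpr ⟨rfl, Subgroup.mem_zpowers _⟩, fun x hx => ?_⟩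
  obtain ⟨n, rfl⟩ := eq_embU_of_mem_inertia₄ G s a hl ha h5 h6 hx
  refine Subgroup.le_topologicalClosure _ ?_
  rw [map_zpow]
  exact Subgroup.zpow_mem _ (Subgroup.mem_zpowers _) n

include hs in
/-- **(L2a) at `pedOf₄`.** [cite: Mochizuki2012, IUTchI §1 p.37] -/
theorem inertia_ε1_image_order₄ : (pedOf₄ F E Fbar l G g s a hl ha h5 h6).deltaEpsKer.relIndex ((pedOf₄ F E Fbar l G g s a hl ha h5 h6).inertia (pedOf₄ F E Fbar l G g s a hl ha h5 h6).ε1 ⊔ (pedOf₄ F E Fbar l G g s a hl ha h5 h6).deltaEpsKer) = (pedOf₄ F E Fbar l G g s a hl ha h5 h6).l := by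
  have hz : embU G (U.e (s (QuotientGroup.mk a))) ∈ (pedOf₄ F E Fbar l G g s a hl ha h5 h6).inertia (pedOf₄ F E Fbar l G g s a hl ha h5 h6).ε1 :=
    (mem_inertia₄ G s a hl ha h5 h6).mpr ⟨rfl, Subgroup.mem_zpowers _⟩
  refine PuncturedEllipticData.relIndex_eq_of_le_zpowers_sup le_sup_right
    (PuncturedEllipticData.normal_subgroupOf_of_modLKer_le (pedOf₄ F E Fbar l G g s a hl ha h5 h6).modLKer_le_deltaEpsKer le_sup_right
      (sup_le ((pedOf₄ F E Fbar l G g s a hl ha h5 h6).inertia_le_deltaXbar _) (pedOf₄ F E Fbar l G g s a hl ha h5 h6).deltaEpsKer_le_deltaXbar))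
    (Subgroup.mem_sup_left hz) (sup_le (fun x hx => ?_) le_sup_right) ?_ fun d hd => ?_
  · obtain ⟨n, rfl⟩ := eq_embU_of_mem_inertia₄ G s a hl ha h5 h6 hx
    refine Subgroup.mem_sup_left ?_
    rw [map_zpow]
    exact Subgroup.zpow_mem _ (Subgroup.mem_zpowers _) n
  · show embU G (U.e (s (QuotientGroup.mk a))) ^ l ∈ (pedOf₄ F E Fbar l G g s a hl ha h5 h6).deltaEpsKer
    rw [← map_pow, U.pow_l, map_one]
    exact one_mem _
  · have hd' : embU G (U.e (s (QuotientGroup.mk a)) ^ (d : ℤ)) ∈ (pedOf₄ F E Fbar l G g s a hl ha h5 h6).deltaEpsKer := by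
      rw [map_zpow, zpow_natCast]; exact hd
    have := cast_eq_zero_of_embU_e_ε1_zpow_mem G s a hl ha h5 h6 hs (deltaEpsKer_le_lamKer₄ G s a hl ha h5 h6 hs hd')
    rw [Int.cast_natCast] at this
    exact (ZMod.natCast_eq_zero_iff d l).mp this

include hs in
/-- **(L2c) at `pedOf₄`.** [cite: Mochizuki2012, IUTchI §1 p.37] -/
theorem inertia_images_inf_le₄ : (pedOf₄ F E Fbar l G g s a hl ha h5 h6).inertia (pedOf₄ F E Fbar l G g s a hl ha h5 h6).ε1 ⊓ ((pedOf₄ F E Fbar l G g s a hl ha h5 h6).inertia (pedOf₄ F E Fbar l G g s a hl ha h5 h6).ε2 ⊔ (pedOf₄ F E Fbar l G g s a hl ha h5 h6).deltaEpsKer) ≤ (pedOf₄ F E Fbar l G g s a hl ha h5 h6).deltaEpsKer := by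
  intro x hx
  obtain ⟨hx1, hx2⟩ := Subgroup.mem_inf.mp hx
  obtain ⟨n, rfl⟩ := eq_embU_of_mem_inertia₄ G s a hl ha h5 h6 hx1
  have hM := sup_le (inertia_le_lamKer₄ G s a hl ha h5 h6 hs (pedOf₄ F E Fbar l G g s a hl ha h5 h6).ε1_ne_ε2.symm)
    (deltaEpsKer_le_lamKer₄ G s a hl ha h5 h6 hs) hx2
  have h0 := cast_eq_zero_of_embU_e_ε1_zpow_mem G s a hl ha h5 h6 hs hM
  rw [U.zpow_eq_one_of_cast_eq_zero _ h0, map_one]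
  exact one_mem _

include hs in
/-- **NV: abc-iut-L5-t1's `ModLCuspLaws` HOLDS at the single-point datum `pedOf₄`.** [cite: Mochizuki2012, IUTchI §1 pp.37–38] -/
theorem modLCuspLaws₄ : (pedOf₄ F E Fbar l G g s a hl ha h5 h6).ModLCuspLaws where
  modLKer_relIndex_ne_zero := modLKer_relIndex_ne_zero₄ G s a hl ha h5 h6
  inertia_procyclic := inertia_procyclic₄ G s a hl ha h5 h6
  inertia_ε1_image_order := inertia_ε1_image_order₄ G s a hl ha h5 h6 hs
  inertia_images_inf_le := inertia_images_inf_le₄ G s a hl ha h5 h6 hs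
  iota_neg := iota_neg₄ G s a hl ha h5 h6 hs
  inertia_central := inertia_central₄ G s a hl ha h5 h6

end Laws

end TorsionCuspModel

namespace InitialThetaData

open Literature.AnabelianGeometry.AbsoluteAnabelian TorsionMonodromyModel TorsionCuspModel
open scoped WeierstrassCurve.Affine Classical

variable {F K Fbar : Type u} [Field F] [NumberField F] [Field K] [NumberField K] [Algebra F K] [Field Fbar]
  [Algebra F Fbar] [Algebra K Fbar] {E : WeierstrassCurve F} [E.IsElliptic] {l : ℕ} {Pb : BadPlacePredicates K}

/-- **t1's `ModLCuspLaws` at `regeom₄`.** [cite: Mochizuki2012, IUTchI §1 pp.37–38] -/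
theorem modLCuspLawsRegeom₄ (D₀ : InitialThetaData F K Fbar E l Pb) : D₀.regeom₄.geom.pe.ModLCuspLaws := by
  haveI := D₀.isAlgClosure
  haveI := D₀.isScalarTower
  haveI : NeZero l := ⟨D₀.l_prime.ne_zero⟩
  haveI : CompactSpace (galoisSubgroupOf F K Fbar) :=
    isCompact_iff_compactSpace.mp (ThetaGeometryModel.isClosed_galoisSubgroupOf F K Fbar).isCompact
  exact TorsionCuspModel.modLCuspLaws₄ (galoisSubgroupOf F K Fbar) Quotient.out D₀.coGen D₀.l_prime D₀.coGen_not_mem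
    D₀.five_le_l (coprime_six_of_prime l D₀.l_prime D₀.five_le_l) QuotientGroup.out_eq'

/-- **The printed §1 claims `ArrowCoveringClaims` at `regeom₄`** (t1 p448117 BY NAME). [cite: Mochizuki2012, IUTchI §1 p.38] -/
theorem arrowCoveringClaimsRegeom₄ (D₀ : InitialThetaData F K Fbar E l Pb) : D₀.regeom₄.geom.pe.ArrowCoveringClaims :=
  D₀.regeom₄.arrowCoveringClaims_pe_of_modLCuspLaws D₀.cuspGaloisRegeom₄ D₀.modLCuspLawsRegeom₄

/-- **FULL JOINT NON-VACUITY `{CG, M′ ⊇ (M, hI), hL, hA, hS}` AT ONE DATUM over the same `(V^bad_mod, V̲)`** (NV-L5 row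
«JOINT-NV-CG (l cusps)» CLOSED): every DATA/LAW binder of abc-iut-L5-d5's `Λ`-assembly (p446888) and of abc-iut-L5-t4's
§6 kits (p448457) is inhabited JOINTLY at `regeom₄`. [cite: Mochizuki2012, IUTchI Def 6.1 (v) p.158] -/
theorem exists_joint_cuspGalois_unramified_laws_claims_normaliserStable (D₀ : InitialThetaData F K Fbar E l Pb) :
    ∃ D : InitialThetaData F K Fbar E l Pb, D.VbadMod = D₀.VbadMod ∧ D.V = D₀.V ∧
      ∃ (_ : D.geom.pe.CuspGalois) (_ : D.UnramifiedTorsionMonodromy),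
        D.geom.pe.ModLCuspLaws ∧ D.geom.pe.ArrowCoveringClaims ∧ D.CuspClassesNormaliserStable :=
  ⟨D₀.regeom₄, rfl, rfl, D₀.cuspGaloisRegeom₄, D₀.unramifiedTorsionMonodromyRegeom₄, D₀.modLCuspLawsRegeom₄,
    D₀.arrowCoveringClaimsRegeom₄, D₀.cuspClassesNormaliserStable_regeom₄⟩

/-- **abc-iut-L5-d5's `Λ`-assembly FIRES non-vacuously**: at `regeom₄`, for EVERY decomposition group `G_v̲ ≤ G_F`,
abc-iut-L5-t4's binder type `LocalArrowLaw CG hS (Π_{X̲→_K} ∩ augGF⁻¹ G_v̲)` is INHABITED (via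
`UnramifiedTorsionMonodromy.localArrowLaw_local`, p448163/p446888). [cite: Mochizuki2012, IUTchI Def 6.1 (iii) p.157] -/
theorem nonempty_localArrowLaw_regeom₄ [Fact l.Prime] (D₀ : InitialThetaData F K Fbar E l Pb)
    (Gv : Subgroup (Fbar ≃ₐ[F] Fbar)) :
    Nonempty (D₀.regeom₄.LocalArrowLaw D₀.cuspGaloisRegeom₄ D₀.cuspClassesNormaliserStable_regeom₄
      (D₀.regeom₄.PiXarrow ⊓ Gv.comap D₀.regeom₄.augGF)) :=
  ⟨D₀.unramifiedTorsionMonodromyRegeom₄.localArrowLaw_local D₀.cuspGaloisRegeom₄ D₀.cuspClassesNormaliserStable_regeom₄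
    D₀.arrowCoveringClaimsRegeom₄ Gv⟩

end InitialThetaData
end Literature.IUT.HodgeTheaters
end
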